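import Summits.NavierStokesRegularity.NavierStokesRegularity.Theses.FilamentSkeletonRss

/-!
# Disproof of `CoreGluing` (stmt-NavierStokesRegularity-15401) — findings

Work file of the crux disprover (cdisprove), cycle 1.  Prose only in docstrings.

* **Structure.** `CoreGluing := SkeletonEquilibrium → RssProfileExists` is a material implication
  between two CLOSED propositions (no shared variable: the angular speed `α` of the profile is NOT
  tied to the skeleton's `α`, although the informal text says "at the skeleton's α").  Hence
  `¬ CoreGluing ↔ SkeletonEquilibrium ∧ ¬ RssProfileExists` (`not_coreGluing_iff`): an unconditional
  refutation needs BOTH the 2001 skeleton theorem (crux #2, stmt-15400) AND the rotating-self-similar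
  Liouville theorem in the window `α ≈ 1` (Tsai Conj. 8.9 = Pineau–Vicol Conj. 1.1, OPEN as of
  arXiv:2607.09619).  This is WHY the crux resists a cheap kill.
* **Load-bearing analysis (section `Threshold`).**  Every clause of the hypothesis
  `SkeletonEquilibrium` EXCEPT the supercritical-stretching threshold `3/2 + δ ≤ w′(τ*)` is satisfied,
  for every `Γ`, by the bare rotation axis `Ξ(τ) = τ e₃` with `w(τ) = τ/2` (pure Leray drift,
  `w′ ≡ 1/2`; the regularised Biot–Savart self-induction of a straight line vanishes identically and
  `e₃ × Ξ = 0`).  Formally: the threshold family `SkeletonEquilibriumAt θ` (verbatim copy with `3/2`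
  replaced by `θ`; `SkeletonEquilibriumAt (3/2) ↔ SkeletonEquilibrium` by `Iff.rfl`) holds for every
  `θ < 1/2` (`skeletonEquilibriumAt_of_lt_half`), so `CoreGluingAt θ ↔ RssProfileExists` for
  `θ < 1/2` (`coreGluingAt_iff_rssProfileExists`): below the Leray-drift value the crux IS the open
  target.  Any proof of `CoreGluing` must use supercriticality `w′(τ*) > 3/2` (equivalently the
  positivity of the Burgers core area `A = 4/(w′ − 3/2)`, support item CoreAreaNecessity); an argument
  insensitive to the threshold would prove `RssProfileExists` outright.
* **Tightness of the drift value (section `Parallel`).**  The axis witness is not an artefact of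
  `N = 1`: for EVERY configuration of straight filaments parallel to the rotation axis (any `N`,
  positions, circulation ratios, `α`, `Γ`) satisfying the relative-equilibrium identity, the
  tangential speeds are `w_j(τ) = ½(⟪p_j,e₃⟫ + τ)` (`parallel_lines_drift`), so `w_j′ ≡ 1/2` and the
  supercritical clause fails for every `δ > −1` (`parallel_lines_not_supercritical`): supercritical
  stretching can only come from skew mutual induction.
* **No junk on the conclusion side.** `RssProfileExists` is not formally contradictory: the symmetry
  clause `∀ c > 0, IsRotatedDSS c (Rot (−2α log c)) u` is consistent (group law of the pinned rotations;
  at `t ≥ 0` the slices may be `0`), Type-I decay of the RSS field is `‖U y‖ ≤ C₀/(‖y‖+1)`, and the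
  duality (mild) identity is a genuine constraint in the Type-I class (all Bochner integrands are
  integrable there), so no junk witness either.  Not refutable / not trivial by typing.
* **Barrier reduction.** The only catalogued barrier touching the conclusion is
  `Literature.Barriers.NavierStokesRegularity.LeraySelfSimilarBlowupExclusionNarrow` (Pineau–Vicol 2026,
  Thm. 1.4, in tree as `pineauVicol2026_rss_liouville_holds`): Type-I RSS profiles vanish for
  `|α| < α_(C₀)` or `|α| > ᾱ(C₀)`, thresholds EXISTENTIAL (no size information in print or in tree).
  The crux keeps `α` fixed (the skeleton's) while `C₀ ≲ Γ^{3/2} → ∞`, and the admissible class grows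
  with `C₀`, so the barrier does not bite; it would bite only a variant in which `α → 0` or `α → ∞`
  at bounded `C₀`.  Moreover the tree fact is over CLASSICAL profile pairs, the crux's conclusion over
  ancient MILD Type-I fields — using it negatively would first need the mild ⇒ classical bridge.
* **Literature (2026-08-16).** arXiv search "rotated/rotating self-similar Navier–Stokes": only
  Pineau–Vicol arXiv:2607.09619 (extreme `|α|`); no all-`α` Liouville theorem found (which would make
  `CoreGluing ↔ ¬SkeletonEquilibrium`).  Search degraded: local searchd down, OpenAlex/S2 HTTP 429.
* **Where a substantive kill would have to come from (not reached).**  At the core scale the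
  non-axisymmetric part of the transverse velocity gradient (frame expansion `½`, rotation `α`, mutual
  induction `Γ/d² = O(1)` at `d ~ √Γ`) is `O(1)` in similarity time, and so is viscous damping of
  core-size Kelvin modes (`ν k² = O(1)`), INDEPENDENTLY of `Γ`: the elliptical-instability / resonance
  competition in the linearised rotated-Leray operator at a dressed filament does not scale away as
  `Γ → ∞` (the route's own kill criterion (ii)).  Deciding it needs the spectrum of a strained Burgers
  vortex at circulation Reynolds number `→ ∞` in a rotating frame — not a cheap computation, and even
  an instability would not refute the FORMAL crux, whose truth value is `¬SkeletonEquilibrium ∨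
  RssProfileExists`.  Recorded for the provers: the uniform-in-`Γ` invertibility modulo symmetry
  (child `LinearisedInvertibility`) is where the mathematics is, and nothing in the HYPOTHESIS
  `SkeletonEquilibrium` (bare existence of skeletons along a sequence `Γ → ∞`, no non-degeneracy, no
  uniform bounds on `w` beyond differentiability) feeds it.
* **Statement-design remark (for the planner; not a refutation).**  As typed, the hypothesis exports,
  uniformly in `Γ`, only `N, γ, α, δ, ρ, K`; it exports NO `Γ`-uniform `C^k` bounds on `(Ξ_j, w_j)`
  (e.g. on `w_j′` near `τ*`, on the size of the supercritical neighbourhood, on `|w_j|` growth), NO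
  non-degeneracy of the relative equilibrium (invertibility of the linearised tangency map modulo
  rotation about `e₃`), and skeletons only along SOME sequence `Γ → ∞`; and the conclusion's `α` is
  not tied to the skeleton's.  The informal mechanism (Lyapunov–Schmidt at the dressed skeleton,
  residual `O(Γ^{-1/2})`) consumes exactly these, so a prover of `CoreGluing` must re-prove a
  QUANTITATIVE skeleton theorem inside `CoreGluing` — the implication is formally no easier than
  `RssProfileExists` plus bookkeeping.  A reshaped pair (SkeletonEquilibrium exporting uniform bounds +
  non-degeneracy; CoreGluing concluding the profile at the skeleton's `α`) would make the split real.
-/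

set_option linter.dupNamespace false

namespace Summit.NavierStokesRegularity.NavierStokesRegularity.Cruxes.CoreGluing.Disproof

open Summit.NavierStokesRegularity.NavierStokesRegularity.Theses.FilamentSkeletonRss
open Literature.Analysis.FluidPDE MeasureTheory
open scoped RealInnerProductSpace InnerProductSpace

/-! ## Structure of the crux -/

/-- `CoreGluing` unfolds to the implication between the two closed route propositions. [folklore] -/
theorem coreGluing_iff : CoreGluing ↔ (SkeletonEquilibrium → RssProfileExists) := Iff.rfl

/-- A refutation of `CoreGluing` is EXACTLY the conjunction "skeleton theorem ∧ RSS Liouville theorem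
in the filament window": both conjuncts are hard (the second is Perelman's open conjecture).
[folklore] -/
theorem not_coreGluing_iff : ¬ CoreGluing ↔ (SkeletonEquilibrium ∧ ¬ RssProfileExists) := by
  unfold CoreGluing
  exact Classical.not_imp

/-- Conversely the crux is implied by its conclusion alone (the hypothesis may go unused). [folklore] -/
theorem coreGluing_of_rssProfileExists (h : RssProfileExists) : CoreGluing := fun _ => h

/-- … and by the failure of its hypothesis alone. [folklore] -/
theorem coreGluing_of_not_skeletonEquilibrium (h : ¬ SkeletonEquilibrium) : CoreGluing :=
  fun hS => absurd hS h

/-! ## Threshold family: which clause of the hypothesis is load-bearing -/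

section Threshold

/-- `SkeletonEquilibrium` with the supercritical-stretching threshold `3/2` replaced by a parameter
`θ`: verbatim copy of the route decl, last clause `θ + δ ≤ deriv (w j) τs`. [folklore] -/
def SkeletonEquilibriumAt (θ : ℝ) : Prop :=
  ∃ (N : ℕ) (γ : Fin N → ℝ) (α δ ρ K : ℝ), 0 < N ∧ α ≠ 0 ∧ 0 < δ ∧ 0 < ρ ∧ (∀ j, γ j ≠ 0) ∧ ∀ Γ₀ : ℝ, ∃ Γ : ℝ, Γ₀ ≤ Γ ∧ 0 < Γ ∧ ∃ (Ξ : Fin N → ℝ → EuclideanSpace ℝ (Fin 3)) (w : Fin N → ℝ → ℝ), (∀ j, ContDiff ℝ 2 (Ξ j) ∧ Function.Injective (Ξ j) ∧ Differentiable ℝ (w j) ∧ (∀ τ, ‖deriv (Ξ j) τ‖ = 1) ∧ (∀ τ, ‖iteratedDeriv 2 (Ξ j) τ‖ * Real.sqrt Γ ≤ K) ∧ Filter.Tendsto (fun τ => ‖Ξ j τ‖) Filter.atTop Filter.atTop ∧ Filter.Tendsto (fun τ => ‖Ξ j τ‖) Filter.atBot Filter.atTop) ∧ (∀ j k, j ≠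 k → ∀ τ σ, ρ * Real.sqrt Γ ≤ ‖Ξ j τ - Ξ k σ‖) ∧ (∀ j (x : EuclideanSpace ℝ (Fin 3)), MeasureTheory.Integrable (fun σ : ℝ => ((‖x - Ξ j σ‖ ^ 2 + 1) ^ (3 / 2 : ℝ))⁻¹ • Literature.Analysis.FluidPDE.cross (deriv (Ξ j) σ) (x - Ξ j σ))) ∧ (∀ j τ, (∑ k : Fin N, (Γ * γ k / (4 * Real.pi)) • ∫ σ : ℝ, ((‖Ξ j τ - Ξ k σ‖ ^ 2 + 1) ^ (3 / 2 : ℝ))⁻¹ • Literature.Analysis.FluidPDE.cross (deriv (Ξ k) σ) (Ξ j τ - Ξ k σ)) + (1 / 2 : ℝ) • Ξ j τ - α • Literature.Analysis.FluidPDE.cross (EuclideanSpace.single (2 : Fin 3) (1 : ℝ)) (Ξ j τ) = w j τ • deriv (Ξ j) τ) ∧ (∀ j, ∃ τs : ℝ, w j τs = 0 ∧ (∀ τ, w j τ = 0 → τ = τs) ∧ θ + δ ≤ deriv (w j) τs)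

/-- At `θ = 3/2` the family member is the route hypothesis, definitionally. [folklore] -/
theorem skeletonEquilibriumAt_three_halves_iff :
    SkeletonEquilibriumAt (3 / 2) ↔ SkeletonEquilibrium := Iff.rfl

/-- The family is antitone in the threshold. [folklore] -/
theorem SkeletonEquilibriumAt.anti {θ θ' : ℝ} (hle : θ' ≤ θ) (h : SkeletonEquilibriumAt θ) :
    SkeletonEquilibriumAt θ' := by
  obtain ⟨N, γ, α, δ, ρ, K, hN, hα, hδ, hρ, hγ, H⟩ := h
  refine ⟨N, γ, α, δ, ρ, K, hN, hα, hδ, hρ, hγ, fun Γ₀ => ?_⟩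
  obtain ⟨Γ, h1, h2, Ξ, w, hA, hB, hC, hD, hE⟩ := H Γ₀
  refine ⟨Γ, h1, h2, Ξ, w, hA, hB, hC, hD, fun j => ?_⟩
  obtain ⟨τs, h0, huniq, hsc⟩ := hE j
  exact ⟨τs, h0, huniq, by linarith⟩

/-- Linearity of the tree's cross product in the second slot (scalars). [folklore] -/
theorem cross_smul_right (a b : EuclideanSpace ℝ (Fin 3)) (r : ℝ) :
    cross a (r • b) = r • cross a b := by
  simp [cross, map_smul]

/-- Linearity of the tree's cross product in the second slot (differences). [folklore] -/
theorem cross_sub_right (a b c : EuclideanSpace ℝ (Fin 3)) :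
    cross a (b - c) = cross a b - cross a c := by
  simp [cross, map_sub]

/-- `a × a = 0`. [folklore] -/
theorem cross_self_eq_zero (a : EuclideanSpace ℝ (Fin 3)) : cross a a = 0 := by
  simp [cross]

/-- **The axis witness.**  For every threshold `θ < 1/2` the skeleton hypothesis holds, witnessed for
every `Γ` by the single straight filament `Ξ(τ) = τ e₃` (the rotation axis) with tangential speed
`w(τ) = τ/2`: unit speed, zero curvature, proper, regularised self-induction `≡ 0`
(`e₃ × (τ−σ)e₃ = 0`), `e₃ × Ξ = 0`, so the relative-equilibrium identity reads `½ τ e₃ = (τ/2) e₃`;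
the unique stagnation point is `τ* = 0` with `w′(0) = 1/2` — pure Leray drift.  Hence the ONLY
clause of `SkeletonEquilibrium` not inhabited by a vorticity-free junk object is the supercritical
threshold `w′(τ*) ≥ 3/2 + δ`. [folklore] -/
theorem skeletonEquilibriumAt_of_lt_half {θ : ℝ} (hθ : θ < 1 / 2) : SkeletonEquilibriumAt θ := by
  classical
  set e₃ : EuclideanSpace ℝ (Fin 3) := EuclideanSpace.single (2 : Fin 3) (1 : ℝ) with he₃
  have hne₃ : ‖e₃‖ = 1 := by simp [he₃]
  have he₃0 : e₃ ≠ 0 := by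
    intro h; rw [h, norm_zero] at hne₃; exact zero_ne_one hne₃
  -- the axis and its speed
  set Ξ₀ : ℝ → EuclideanSpace ℝ (Fin 3) := fun τ => τ • e₃ with hΞ₀
  have hderiv : deriv Ξ₀ = fun _ => e₃ := by
    funext τ
    rw [hΞ₀, deriv_smul_const differentiableAt_id, deriv_id'', one_smul]
  have hderiv2 : iteratedDeriv 2 Ξ₀ = fun _ => 0 := by
    rw [iteratedDeriv_succ, iteratedDeriv_one, hderiv]
    funext τ
    exact deriv_const τ e₃
  refine ⟨1, fun _ => 1, 1, 1 / 2 - θ, 1, 0, Nat.one_pos, one_ne_zero, by linarith, one_pos,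
    fun _ => one_ne_zero, fun Γ₀ => ⟨max Γ₀ 1, le_max_left _ _, lt_of_lt_of_le one_pos (le_max_right _ _),
    fun _ => Ξ₀, fun _ τ => τ / 2, ?_, ?_, ?_, ?_, ?_⟩⟩
  · -- regularity, unit speed, zero curvature, properness
    intro j
    refine ⟨contDiff_id.smul contDiff_const, smul_left_injective ℝ he₃0,
      differentiable_id.div_const _, fun τ => by rw [hderiv, hne₃], fun τ => ?_, ?_, ?_⟩
    · rw [hderiv2]; simp
    · have : (fun τ : ℝ => ‖Ξ₀ τ‖) = fun τ => |τ| := by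
        funext τ; simp [hΞ₀, norm_smul, hne₃]
      rw [this]; exact Filter.tendsto_abs_atTop_atTop
    · have : (fun τ : ℝ => ‖Ξ₀ τ‖) = fun τ => |τ| := by
        funext τ; simp [hΞ₀, norm_smul, hne₃]
      rw [this]; exact Filter.tendsto_abs_atBot_atTop
  · -- pairwise separation: vacuous for one filament
    intro j k hjk
    exact absurd (Subsingleton.elim j k) hjk
  · -- integrability of the regularised Biot–Savart integrand at every point
    intro j x
    have hcross : ∀ σ : ℝ, cross (deriv Ξ₀ σ) (x - Ξ₀ σ) = cross e₃ x := by
      intro σ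
      rw [hderiv]
      simp only [hΞ₀]
      rw [cross_sub_right, cross_smul_right, cross_self_eq_zero, smul_zero, sub_zero]
    simp_rw [hcross]
    refine Integrable.smul_const ?_ _
    -- domination by the integrable Cauchy kernel `(1 + (σ - x₂)²)⁻¹`
    have hcoord : ∀ σ : ℝ, (x 2 - σ) ^ 2 + 1 ≤ ‖x - Ξ₀ σ‖ ^ 2 + 1 := by
      intro σ
      have h2 : (x - Ξ₀ σ) 2 = x 2 - σ := by
        simp [hΞ₀, he₃]
      have := EuclideanSpace.norm_sq_eq (x - Ξ₀ σ)
      rw [this]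
      have hle : ‖(x - Ξ₀ σ) 2‖ ^ 2 ≤ ∑ i, ‖(x - Ξ₀ σ) i‖ ^ 2 :=
        Finset.single_le_sum (f := fun i => ‖(x - Ξ₀ σ) i‖ ^ 2) (fun i _ => sq_nonneg _)
          (Finset.mem_univ 2)
      rw [h2, Real.norm_eq_abs, sq_abs] at hle
      linarith
    have hcont : Continuous fun σ : ℝ => ((‖x - Ξ₀ σ‖ ^ 2 + 1) ^ (3 / 2 : ℝ))⁻¹ := by
      have hc : Continuous fun σ : ℝ => ‖x - Ξ₀ σ‖ ^ 2 + 1 := by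
        simp only [hΞ₀]; fun_prop
      refine (hc.rpow_const fun σ => Or.inr (by norm_num)).inv₀ fun σ => ?_
      exact (Real.rpow_pos_of_pos (by positivity) _).ne'
    refine Integrable.mono' ((integrable_inv_one_add_sq).comp_sub_right (x 2))
      hcont.aestronglyMeasurable (Filter.Eventually.of_forall fun σ => ?_)
    have hb1 : 1 ≤ ‖x - Ξ₀ σ‖ ^ 2 + 1 := by nlinarith [sq_nonneg ‖x - Ξ₀ σ‖]
    have hbpos : 0 < ‖x - Ξ₀ σ‖ ^ 2 + 1 := by positivity
    rw [Real.norm_eq_abs, abs_of_nonneg (inv_nonneg.2 (Real.rpow_nonneg hbpos.le _))]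
    calc ((‖x - Ξ₀ σ‖ ^ 2 + 1) ^ (3 / 2 : ℝ))⁻¹ ≤ (‖x - Ξ₀ σ‖ ^ 2 + 1)⁻¹ := by
          refine inv_anti₀ hbpos ?_
          conv_lhs => rw [← Real.rpow_one (‖x - Ξ₀ σ‖ ^ 2 + 1)]
          exact Real.rpow_le_rpow_of_exponent_le hb1 (by norm_num)
      _ ≤ ((x 2 - σ) ^ 2 + 1)⁻¹ := inv_anti₀ (by positivity) (hcoord σ)
      _ = (1 + (σ - x 2) ^ 2)⁻¹ := by ring
  · -- the relative-equilibrium identity: ½ τ e₃ = (τ/2) e₃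
    intro j τ
    have hcross : ∀ σ : ℝ, cross (deriv Ξ₀ σ) (Ξ₀ τ - Ξ₀ σ) = 0 := by
      intro σ
      rw [hderiv]
      simp only [hΞ₀]
      rw [← sub_smul, cross_smul_right, cross_self_eq_zero, smul_zero]
    have haxis : cross (EuclideanSpace.single (2 : Fin 3) (1 : ℝ)) (Ξ₀ τ) = 0 := by
      simp only [hΞ₀]
      rw [cross_smul_right, ← he₃, cross_self_eq_zero, smul_zero]
    simp_rw [hcross, smul_zero, integral_zero, smul_zero, Finset.sum_const_zero, zero_add, haxis,
      smul_zero, sub_zero, hderiv]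
    simp only [hΞ₀, smul_smul]
    congr 1
    ring
  · -- unique stagnation point τ* = 0 with w′(0) = 1/2 = θ + δ
    intro j
    refine ⟨0, by norm_num, fun τ hτ => by linarith, ?_⟩
    have : deriv (fun τ : ℝ => τ / 2) 0 = 1 / 2 := by
      rw [deriv_div_const, deriv_id'']
    rw [this]
    linarith

/-- The crux at threshold `θ`. [folklore] -/
def CoreGluingAt (θ : ℝ) : Prop :=
  SkeletonEquilibriumAt θ → RssProfileExists

/-- At `θ = 3/2` this is `CoreGluing`, definitionally. [folklore] -/
theorem coreGluingAt_three_halves_iff : CoreGluingAt (3 / 2) ↔ CoreGluing := Iff.rfl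

/-- `CoreGluingAt` is monotone in the threshold (a larger threshold is a stronger hypothesis). [folklore] -/
theorem CoreGluingAt.mono {θ θ' : ℝ} (hle : θ ≤ θ') (h : CoreGluingAt θ) : CoreGluingAt θ' :=
  fun hS => h (hS.anti hle)

/-- **Load-bearing clause.**  Below the Leray-drift value `1/2` the hypothesis is free, so the crux
with the threshold dropped/lowered IS the open target `RssProfileExists` (¬ Perelman–Tsai–Pineau–Vicol
RSS conjecture in the window): no refutation and no proof of it is cheap. [folklore] -/
theorem coreGluingAt_iff_rssProfileExists {θ : ℝ} (hθ : θ < 1 / 2) :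
    CoreGluingAt θ ↔ RssProfileExists :=
  ⟨fun h => h (skeletonEquilibriumAt_of_lt_half hθ), fun h _ => h⟩

/-- In particular the route's crux is implied by every sub-drift member of the family. [folklore] -/
theorem coreGluing_of_coreGluingAt {θ : ℝ} (hθ : θ ≤ 3 / 2) (h : CoreGluingAt θ) : CoreGluing :=
  coreGluingAt_three_halves_iff.1 (h.mono hθ)

end Threshold

/-! ## Tightness of the drift value: axis-parallel cages are never supercritical -/

section Parallel

/-- **Axis-parallel filaments drift at exactly the Leray rate.**  If every filament of a
configuration is a straight line parallel to the rotation axis, `Ξ_j(τ) = p_j + τ e₃` (any number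
`N`, any positions `p_j`, any circulation ratios, any `α`, `Γ`), and the relative-equilibrium identity
of `SkeletonEquilibrium` holds with tangential speeds `w_j`, then `w_j(τ) = ½(⟪p_j, e₃⟫ + τ)`:
the regularised Biot–Savart induction of parallel lines and the frame rotation are horizontal, so only
the Leray drift `½Ξ` has an axial component.  (The `e₃`-component of the identity; the Bochner
integral of a horizontal field is horizontal whether or not it converges.) [folklore] -/
theorem parallel_lines_drift {N : ℕ} (γ : Fin N → ℝ) (α Γ : ℝ)
    (p : Fin N → EuclideanSpace ℝ (Fin 3)) (Ξ : Fin N → ℝ → EuclideanSpace ℝ (Fin 3))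
    (hΞ : ∀ j, Ξ j = fun τ => p j + τ • EuclideanSpace.single (2 : Fin 3) (1 : ℝ))
    (w : Fin N → ℝ → ℝ)
    (heq : ∀ j τ, (∑ k : Fin N, (Γ * γ k / (4 * Real.pi)) • ∫ σ : ℝ, ((‖Ξ j τ - Ξ k σ‖ ^ 2 + 1) ^ (3 / 2 : ℝ))⁻¹ • Literature.Analysis.FluidPDE.cross (deriv (Ξ k) σ) (Ξ j τ - Ξ k σ)) + (1 / 2 : ℝ) • Ξ j τ - α • Literature.Analysis.FluidPDE.cross (EuclideanSpace.single (2 : Fin 3) (1 : ℝ)) (Ξ j τ) = w j τ • deriv (Ξ j) τ)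
    (j : Fin N) (τ : ℝ) :
    w j τ = (1 / 2) * (⟪p j, EuclideanSpace.single (2 : Fin 3) (1 : ℝ)⟫_ℝ + τ) := by
  set e₃ : EuclideanSpace ℝ (Fin 3) := EuclideanSpace.single (2 : Fin 3) (1 : ℝ) with he₃
  -- axial components: `⟪e₃ × v, e₃⟫ = 0`, `⟪e₃, e₃⟫ = 1`
  have hperp : ∀ v : EuclideanSpace ℝ (Fin 3), ⟪cross e₃ v, e₃⟫_ℝ = 0 := by
    intro v
    simp [he₃, cross, cross_apply, EuclideanSpace.inner_single_right]
  have hperp' : ∀ v : EuclideanSpace ℝ (Fin 3), ⟪e₃, cross e₃ v⟫_ℝ = 0 := fun v => by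
    rw [real_inner_comm]; exact hperp v
  have hunit : ⟪e₃, e₃⟫_ℝ = 1 := by
    simp [he₃]
  have hderiv : ∀ k σ, deriv (Ξ k) σ = e₃ := by
    intro k σ
    rw [hΞ k]
    rw [deriv_const_add, deriv_smul_const differentiableAt_id, deriv_id'', one_smul]
  -- the Bochner integral of a horizontal field is horizontal (or zero)
  have hint : ∀ k, ⟪(∫ σ : ℝ, ((‖Ξ j τ - Ξ k σ‖ ^ 2 + 1) ^ (3 / 2 : ℝ))⁻¹ •
      cross e₃ (Ξ j τ - Ξ k σ)), e₃⟫_ℝ = 0 := by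
    intro k
    by_cases hI : Integrable (fun σ : ℝ => ((‖Ξ j τ - Ξ k σ‖ ^ 2 + 1) ^ (3 / 2 : ℝ))⁻¹ •
        cross e₃ (Ξ j τ - Ξ k σ))
    · rw [real_inner_comm, ← integral_inner hI]
      simp_rw [real_inner_smul_right, hperp', mul_zero, integral_zero]
    · rw [integral_undef hI, inner_zero_left]
  have key := congrArg (fun v => ⟪v, e₃⟫_ℝ) (heq j τ)
  simp only [hderiv] at key
  simp only [inner_sub_left, inner_add_left, sum_inner, real_inner_smul_left, hint, mul_zero,
    Finset.sum_const_zero, zero_add, hperp, sub_zero, hunit, mul_one] at key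
  rw [← key, hΞ j]
  simp only [inner_add_left, real_inner_smul_left, hunit, mul_one]

/-- Hence an axis-parallel cage never meets the supercritical clause of `SkeletonEquilibrium`:
`w_j′ ≡ 1/2 < 3/2 + δ` for every `δ > -1`, in particular for the crux's `δ > 0`.  Supercritical
stretching must come from SKEW mutual induction (as in the 2001 certified `C₃` skew triple and
two-ring cage, whose axis line is stretched by the rings). [folklore] -/
theorem parallel_lines_not_supercritical {N : ℕ} (γ : Fin N → ℝ) (α Γ δ : ℝ) (hδ : -1 < δ)
    (p : Fin N → EuclideanSpace ℝ (Fin 3)) (Ξ : Fin N → ℝ → EuclideanSpace ℝ (Fin 3))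
    (hΞ : ∀ j, Ξ j = fun τ => p j + τ • EuclideanSpace.single (2 : Fin 3) (1 : ℝ))
    (w : Fin N → ℝ → ℝ)
    (heq : ∀ j τ, (∑ k : Fin N, (Γ * γ k / (4 * Real.pi)) • ∫ σ : ℝ, ((‖Ξ j τ - Ξ k σ‖ ^ 2 + 1) ^ (3 / 2 : ℝ))⁻¹ • Literature.Analysis.FluidPDE.cross (deriv (Ξ k) σ) (Ξ j τ - Ξ k σ)) + (1 / 2 : ℝ) • Ξ j τ - α • Literature.Analysis.FluidPDE.cross (EuclideanSpace.single (2 : Fin 3) (1 : ℝ)) (Ξ j τ) = w j τ • deriv (Ξ j) τ)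
    (j : Fin N) (τs : ℝ) :
    ¬ (3 / 2 + δ ≤ deriv (w j) τs) := by
  have hw : w j = fun τ => (1 / 2) * (⟪p j, EuclideanSpace.single (2 : Fin 3) (1 : ℝ)⟫_ℝ + τ) :=
    funext fun τ => parallel_lines_drift γ α Γ p Ξ hΞ w heq j τ
  have hd : deriv (w j) τs = 1 / 2 := by
    rw [hw, deriv_const_mul _ (differentiableAt_const _ |>.add differentiableAt_id), deriv_const_add,
      deriv_id'', mul_one]
  rw [hd]
  linarith

end Parallel

end Summit.NavierStokesRegularity.NavierStokesRegularity.Cruxes.CoreGluing.Disproof
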